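import Mathlib
import Literature.AlgebraicGeometry.Resolution.CobordantGame
import Literature.AlgebraicGeometry.Resolution.CobordantChartCoefficients
import Literature.AlgebraicGeometry.Resolution.CobordantChartPlaneSlice
import Literature.AlgebraicGeometry.Resolution.CobordantTupleGame
import Literature.AlgebraicGeometry.Resolution.FormalCoordinateChange
import Summits.ResolutionOfSingularities.ResolutionOfSingularities.Theorems.WeightedInvariantGlobalizeLocalDropCanonize
import Summits.ResolutionOfSingularities.ResolutionOfSingularities.Theorems.WeightedInvariantGlobalizeLocalDropCylinder
import Summits.ResolutionOfSingularities.ResolutionOfSingularities.Theorems.WeightedInvariantGlobalizeLocalDropRegularGerms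
import Summits.ResolutionOfSingularities.ResolutionOfSingularities.Theorems.WeightedInvariantLocalWeightedDropHornedRankEquiv
import Summits.ResolutionOfSingularities.ResolutionOfSingularities.Theorems.WeightedInvariantLocalWeightedDropTangentConeCut
import Summits.ResolutionOfSingularities.ResolutionOfSingularities.Theorems.WeightedInvariantLocalWeightedDropMultiplicityLift
import Summits.ResolutionOfSingularities.ResolutionOfSingularities.Theorems.WeightedInvariantLocalWeightedDropMonicPointBlowup

/-!
# `WeightedInvariant.LocalWeightedDrop`, line `hasse-ridge-face-selection`: the CURVE BLOW-UP of a permissible MONIC form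

Crux item stmt-ResolutionOfSingularities-8899 `LocalWeightedDrop` (route `ResolutionOfSingularities/WeightedInvariant`),
serving the door `WeightedConstruction` stmt-ResolutionOfSingularities-0571.  [OURS · L1 W4.3, chain w43, stub worker 3: the
second move-brick of N3 (the wild lift) of CRUX-PLAN w43 §3C for S2 `stub_charTwoDoublePointSurfaceWon` / S3
`stub_wildUnaryConeSurfaceWon`, on the position space of `WeierstrassForm.exists_monicForm`; companion of
`won_monic_of_pointBlowup`.  Not a statement of any manuscript.]

`won_monic_of_curveBlowup` (every characteristic `p`, every dimension `m + 1`, every degree `d ≥ 1`, every slot `i`): a monic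
form `P = y^d + Σ_{j<d} A_j(x') y^j` which is PERMISSIBLE along the curve `V(x_i, y)` — `A_j = x_i^{d-j} · A'_j` with
`A'_j(0) = 0` (automatic when `ord A_j > d - j`, `constantCoeff_eq_zero_of_eq_X_pow_mul`) — is won as soon as, for every
`c_i ≠ 0`, the monic form
```
  S = y^d + Σ_{j<d} c_i^{d-j} · (A'_j ∘ chart_{e_i}(c_i))|_{x_i' = 0} · y^j      (same number of variables)
```
is won whenever it is singular.  Here the move is the blow-up of `V(x_i, y)` (weights `1` at `x_i` and `y`, `0` elsewhere, no
coordinate change); the transform at the exceptional point `(c', γ)` is `s^d · g₀`,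
`g₀ = (γ + Y)^d + Σ_j (c_i + x_i')^{d-j} (A'_j ∘ chart')♮ (γ + Y)^j` (`MonicCurveBlowup.transform_curve`); `s ∤ g₀` because killing
every variable but `Y` leaves `(γ + Y)^d` (`not_X_dvd_g₀`, via `MultiplicityLift.subst_proj_*`); a singular successor has
`g₀(0) = γ^d = 0` (`constantCoeff_g₀`), so it sits over `γ = 0` where only the slot `x_i` is live — tame of weight `1` — and
`tameSlice` + `slice_g₀` + `won_cyl`/`won_subst_iff`/`won_unit_mul_iff` finish.  These are the two classical moves (point, curve)
of the CJS engine for the wild surface pieces; choosing between them and re-preparing `y ↦ y + φ(x')` is the caller's strategy.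
-/

set_option linter.dupNamespace false -- mandated namespace of this single-conjunct summit

namespace Summit.ResolutionOfSingularities.ResolutionOfSingularities.Theorems

open Literature.AlgebraicGeometry.Resolution
open Literature.AlgebraicGeometry.Resolution.CobordantGame

namespace MonicCurveBlowup

open MvPowerSeries

variable {k : Type} [Field k] {m : ℕ} (i : Fin m)

/-- The weights of the curve blow-up with centre `V(x_i, y)`: `1` at `x_i` and at `y`, `0` elsewhere, as an insertion at the
`y`-slot. -/
theorem curveWeight_eq_insertNth :
    (fun l : Fin (m + 1) => if l = Fin.castSucc i ∨ l = Fin.last m then (1 : ℕ) else 0) =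
      Fin.insertNth (α := fun _ => ℕ) (Fin.last m) 1 (fun l : Fin m => if l = i then 1 else 0) := by
  funext l
  rcases Fin.eq_self_or_eq_succAbove (Fin.last m) l with rfl | ⟨j, rfl⟩
  · rw [Fin.insertNth_apply_same, if_pos (Or.inr rfl)]
  · rw [Fin.insertNth_apply_succAbove, Fin.succAbove_last]
    by_cases hj : j = i
    · rw [if_pos (Or.inl (by rw [hj])), if_pos hj]
    · rw [if_neg hj, if_neg]
      rintro (h | h)
      · exact hj (Fin.castSucc_injective _ h)
      · exact (Fin.castSucc_lt_last j).ne h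

/-- A divisibility `A = x_i^n · A'` with `ord A > n` forces `A'(0) = 0`. -/
theorem constantCoeff_eq_zero_of_eq_X_pow_mul {A A' : MvPowerSeries (Fin m) k} {n : ℕ} (hA : A = X i ^ n * A')
    (hord : (n : ℕ∞) < A.order) : constantCoeff A' = 0 := by
  classical
  have h : coeff (Finsupp.single i n) A = constantCoeff A' := by
    rw [hA, X_pow_eq, coeff_monomial_mul, if_pos le_rfl, tsub_self, one_mul, coeff_zero_eq_constantCoeff_apply]
  rw [← h]
  exact coeff_of_lt_order (by rw [Finsupp.degree_single]; exact hord)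


/-- The slot `x_i` of the chart of `w' = e_i` on `k[[x']]`: `x_i ↦ s · (c_i + x_i')`. -/
theorem cruxChart_slot' (pt' : Fin m → k) :
    cruxChart k (fun l : Fin m => if l = i then (1 : ℕ) else 0) pt' i = X 0 * (C (pt' i) + X i.succ) := by
  simp [cruxChart]

/-- THE TRANSFORM OF A PERMISSIBLE MONIC FORM under the blow-up of the curve `V(x_i, y)` at the exceptional point
`pt = (c', γ)`: with `A_j = x_i^{d-j} A'_j` and `G_j = A'_j ∘ chart'`,
`s^d · ((γ + Y)^d + Σ_j (c_i + x_i')^{d-j} G_j♮ (γ + Y)^j)`. -/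
theorem transform_curve {d : ℕ} (A A' : Fin d → MvPowerSeries (Fin m) k) (hdiv : ∀ j, A j = X i ^ (d - (j : ℕ)) * A' j)
    (pt : Fin (m + 1) → k) :
    subst (cruxChart k (fun l : Fin (m + 1) => if l = Fin.castSucc i ∨ l = Fin.last m then (1 : ℕ) else 0) pt)
        (X (Fin.last m) ^ d + ∑ j : Fin d, rename (Fin.succAboveEmb (Fin.last m)) (A j) * X (Fin.last m) ^ (j : ℕ)) =
      X 0 ^ d * ((C (pt (Fin.last m)) + X (Fin.last (m + 1))) ^ d +
        ∑ j : Fin d, (C (pt (Fin.castSucc i)) + X (Fin.castSucc i).succ) ^ (d - (j : ℕ)) *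
          rename (Fin.succAboveEmb (Fin.last (m + 1)))
            (subst (cruxChart k (fun l : Fin m => if l = i then (1 : ℕ) else 0) (fun l => pt (Fin.castSucc l))) (A' j)) *
          (C (pt (Fin.last m)) + X (Fin.last (m + 1))) ^ (j : ℕ)) := by
  have hWt := curveWeight_eq_insertNth (m := m) i
  set Wt : Fin (m + 1) → ℕ := fun l => if l = Fin.castSucc i ∨ l = Fin.last m then (1 : ℕ) else 0 with hWtdef
  set w' : Fin m → ℕ := fun l => if l = i then (1 : ℕ) else 0 with hw'def
  have hs := hasSubst_of_constantCoeff_zero (constantCoeff_cruxChart (k := k) Wt pt)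
  have hs' := hasSubst_of_constantCoeff_zero (constantCoeff_cruxChart (k := k) w' (fun l => pt (Fin.castSucc l)))
  have hlast : subst (cruxChart k Wt pt) (X (Fin.last m) : MvPowerSeries (Fin (m + 1)) k) =
      X 0 * (C (pt (Fin.last m)) + X (Fin.last (m + 1))) := by
    rw [subst_X hs, MultiplicityLift.cruxChart_last hWt pt, pow_one, if_pos one_pos]
  have hc' : (fun l => pt ((Fin.last m).succAbove l)) = fun l => pt (Fin.castSucc l) := by
    funext l; rw [Fin.succAbove_last]
  have hemb : (Fin.succAboveEmb (Fin.last (m + 1))) i.succ = (Fin.castSucc i).succ := by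
    rw [Fin.coe_succAboveEmb, Fin.succAbove_last, Fin.succ_castSucc]
  have h0 : (Fin.succAboveEmb (Fin.last (m + 1))) (0 : Fin (m + 1)) = 0 := succAboveEmb_succ_zero (Fin.last m)
  have hren : ∀ j, subst (cruxChart k Wt pt) (rename (Fin.succAboveEmb (Fin.last m)) (A j)) =
      (X 0 * (C (pt (Fin.castSucc i)) + X (Fin.castSucc i).succ)) ^ (d - (j : ℕ)) *
        rename (Fin.succAboveEmb (Fin.last (m + 1))) (subst (cruxChart k w' (fun l => pt (Fin.castSucc l))) (A' j)) := by
    intro j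
    rw [MultiplicityLift.subst_cruxChart_rename hWt pt (A j), hc', hdiv j, ← coe_substAlgHom hs', map_mul, map_pow,
      coe_substAlgHom, subst_X hs', cruxChart_slot', map_mul, map_pow, map_mul, map_add, rename_X, rename_C, rename_X,
      hemb, h0]
  rw [← coe_substAlgHom hs]
  simp only [map_add, map_pow, map_sum, map_mul, coe_substAlgHom, hlast, hren]
  rw [mul_add (X 0 ^ d), mul_pow, Finset.mul_sum]
  congr 1
  refine Finset.sum_congr rfl fun j _ => ?_
  have hj : (j : ℕ) < d := j.2
  have hd : (X 0 : MvPowerSeries (Fin (m + 1 + 1)) k) ^ d = X 0 ^ (d - (j : ℕ)) * X 0 ^ (j : ℕ) := by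
    rw [← pow_add]; congr 1; omega
  rw [hd, mul_pow, mul_pow]
  ring

/-- The constant coefficient of the saturated transform is `γ^d` (the `G_j` vanish at the origin). -/
theorem constantCoeff_g₀ {d : ℕ} (γ ci : k) (G : Fin d → MvPowerSeries (Fin (m + 1)) k)
    (hG : ∀ j, constantCoeff (G j) = 0) :
    constantCoeff ((C γ + X (Fin.last (m + 1))) ^ d +
        ∑ j : Fin d, (C ci + X (Fin.castSucc i).succ) ^ (d - (j : ℕ)) *
          rename (Fin.succAboveEmb (Fin.last (m + 1))) (G j) * (C γ + X (Fin.last (m + 1))) ^ (j : ℕ)) = γ ^ d := by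
  rw [map_add, map_pow, map_add, constantCoeff_C, constantCoeff_X, add_zero, map_sum, Finset.sum_eq_zero, add_zero]
  intro j _
  rw [map_mul, map_mul, constantCoeff_rename, hG j, mul_zero, zero_mul]

/-- `s` does not divide the saturated transform: killing every variable but `Y` leaves `(γ + Y)^d ≠ 0`. -/
theorem not_X_dvd_g₀ {d : ℕ} (γ ci : k) (G : Fin d → MvPowerSeries (Fin (m + 1)) k) :
    ¬ X 0 ∣ ((C γ + X (Fin.last (m + 1))) ^ d +
        ∑ j : Fin d, (C ci + X (Fin.castSucc i).succ) ^ (d - (j : ℕ)) *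
          rename (Fin.succAboveEmb (Fin.last (m + 1))) (G j) * (C γ + X (Fin.last (m + 1))) ^ (j : ℕ)) := by
  classical
  rintro ⟨q, hq⟩
  obtain ⟨π, hπ⟩ : ∃ π : Fin (m + 1 + 1) → MvPowerSeries (Fin (m + 1 + 1)) k,
      ∀ l, π l = if l = Fin.last (m + 1) then X l else 0 := ⟨_, fun _ => rfl⟩
  have hπs : HasSubst π := CriticalSection.hasSubst_indSubst hπ
  have hne : (Fin.castSucc i).succ ≠ Fin.last (m + 1) := by
    rw [← Fin.succ_last, Ne, Fin.succ_inj]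
    exact (Fin.castSucc_lt_last i).ne
  have h := congrArg (subst π) hq
  rw [← coe_substAlgHom hπs] at h
  simp only [map_add, map_pow, map_sum, map_mul, coe_substAlgHom, MultiplicityLift.subst_proj_X_zero hπ,
    MultiplicityLift.subst_proj_X_last hπ, MultiplicityLift.subst_proj_rename hπ, subst_C, zero_mul] at h
  rw [subst_X hπs, hπ, if_neg hne] at h
  -- now `h : (C γ + Y)^d + Σ … (C c(G_j(0))) … = 0`; read the `Y^d` coefficient
  have hc := congrArg (coeff (Finsupp.single (Fin.last (m + 1)) d)) h
  rw [map_zero, map_add, map_sum, ← one_mul ((C γ + X (Fin.last (m + 1))) ^ d), ← map_one C,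
    MultiplicityLift.coeff_single_C_mul_add_pow, Nat.choose_self, Nat.sub_self, Finset.sum_eq_zero] at hc
  · simp at hc
  · intro j _
    rw [add_zero, ← map_pow, ← map_mul, MultiplicityLift.coeff_single_C_mul_add_pow,
      Nat.choose_eq_zero_of_lt j.2]
    simp


/-- THE SLICE `x_i' ↦ 0` of the saturated transform at `γ = 0` is the MONIC form `y^d + Σ_j c_i^{d-j} (G_j)| y^j`. -/
theorem slice_g₀ {d : ℕ} (ci : k) (G : Fin d → MvPowerSeries (Fin (m + 1)) k) :
    subst (fun l : Fin (m + 1 + 1) => if l = (Fin.castSucc i).succ then (0 : MvPowerSeries (Fin (m + 1)) k)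
        else X (Fin.predAbove (Fin.castSucc i) l))
      ((C (0 : k) + X (Fin.last (m + 1))) ^ d +
        ∑ j : Fin d, (C ci + X (Fin.castSucc i).succ) ^ (d - (j : ℕ)) *
          rename (Fin.succAboveEmb (Fin.last (m + 1))) (G j) * (C (0 : k) + X (Fin.last (m + 1))) ^ (j : ℕ)) =
      X (Fin.last m) ^ d +
        ∑ j : Fin d, rename (Fin.succAboveEmb (Fin.last m)) (C (ci ^ (d - (j : ℕ))) * TupleGame.slice i (G j)) *
          X (Fin.last m) ^ (j : ℕ) := by
  cases m with
  | zero => exact i.elim0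
  | succ m =>
    have hs := CobordantChartPlaneSlice.hasSubst_slice (R := k) (Fin.castSucc i)
    have hkill : subst (fun l : Fin (m + 1 + 1 + 1) => if l = (Fin.castSucc i).succ then (0 : MvPowerSeries (Fin (m + 1 + 1)) k)
        else X (Fin.predAbove (Fin.castSucc i) l)) (X (Fin.castSucc i).succ : MvPowerSeries (Fin (m + 1 + 1 + 1)) k) = 0 := by
      rw [subst_X hs, if_pos rfl]
    have hC : subst (fun l : Fin (m + 1 + 1 + 1) => if l = (Fin.castSucc i).succ then (0 : MvPowerSeries (Fin (m + 1 + 1)) k)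
        else X (Fin.predAbove (Fin.castSucc i) l)) (C ci : MvPowerSeries (Fin (m + 1 + 1 + 1)) k) = C ci := by
      rw [subst_C]
    rw [map_zero, zero_add, ← coe_substAlgHom hs]
    simp only [map_add, map_mul, map_pow, map_sum]
    simp only [coe_substAlgHom, MultiplicityLift.slice_X_last, MultiplicityLift.slice_rename, hkill, hC, add_zero]
    congr 1
    refine Finset.sum_congr rfl fun j _ => ?_
    rw [rename_C]

end MonicCurveBlowup

open MonicCurveBlowup MvPowerSeries in
/-- THE BLOW-UP OF THE CURVE `V(x_i, y)` FROM A PERMISSIBLE MONIC FORM (every characteristic `p`, every dimension `m + 1`, every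
degree `d ≥ 1`).  Let `P = y^d + Σ_{j<d} A_j(x') y^j` with `A_j = x_i^{d-j} · A'_j` and `A'_j(0) = 0` (so `P ∈ (x_i, y)^d`: the
curve `V(x_i, y)` is permissible; `A'_j(0) = 0` holds as soon as `ord A_j > d - j`, `constantCoeff_eq_zero_of_eq_X_pow_mul`).
Blow up `V(x_i, y)` (weights `1` at `x_i` and `y`, `0` elsewhere, no coordinate change).  Then an exceptional point with
`γ = c_y ≠ 0` carries a unit (no move of Refuter there), and at `γ = 0` (so `c_i ≠ 0`, tame of weight `1`) the saturated successor
is a unit times a coordinate change of the cylinder over the MONIC slice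
`S = y^d + Σ_j c_i^{d-j} · (A'_j ∘ chart_{e_i}(c_i))|_{x_i' = 0} · y^j` (same number of variables).  Hence `P` is won as soon
as every such singular slice is won. -/
theorem won_monic_of_curveBlowup (p : ℕ) (hp : p.Prime) (k : Type) [Field k] [CharP k p] (m d : ℕ) (hd : 0 < d)
    (i : Fin m) (A A' : Fin d → MvPowerSeries (Fin m) k) (hdiv : ∀ j : Fin d, A j = MvPowerSeries.X i ^ (d - (j : ℕ)) * A' j)
    (hA' : ∀ j : Fin d, MvPowerSeries.constantCoeff (A' j) = 0)
    (hsucc : ∀ ci : k, ci ≠ 0 →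
      CobordantGame.IsSingular k (MvPowerSeries.X (Fin.last m) ^ d +
        ∑ j : Fin d, MvPowerSeries.rename (Fin.succAboveEmb (Fin.last m))
          (MvPowerSeries.C (ci ^ (d - (j : ℕ))) * TupleGame.slice i
            (MvPowerSeries.subst (CobordantChart.chart (fun l : Fin m => if l = i then 1 else 0)
              (fun l : Fin m => if l = i then ci else 0)) (A' j))) * MvPowerSeries.X (Fin.last m) ^ (j : ℕ)) →
      CobordantGame.Won k (m + 1) (MvPowerSeries.X (Fin.last m) ^ d +
        ∑ j : Fin d, MvPowerSeries.rename (Fin.succAboveEmb (Fin.last m))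
          (MvPowerSeries.C (ci ^ (d - (j : ℕ))) * TupleGame.slice i
            (MvPowerSeries.subst (CobordantChart.chart (fun l : Fin m => if l = i then 1 else 0)
              (fun l : Fin m => if l = i then ci else 0)) (A' j))) * MvPowerSeries.X (Fin.last m) ^ (j : ℕ))) :
    CobordantGame.Won k (m + 1) (MvPowerSeries.X (Fin.last m) ^ d +
      ∑ j : Fin d, MvPowerSeries.rename (Fin.succAboveEmb (Fin.last m)) (A j) * MvPowerSeries.X (Fin.last m) ^ (j : ℕ)) := by
  classical
  set P : MvPowerSeries (Fin (m + 1)) k := X (Fin.last m) ^ d +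
    ∑ j : Fin d, rename (Fin.succAboveEmb (Fin.last m)) (A j) * X (Fin.last m) ^ (j : ℕ) with hP
  set Wt : Fin (m + 1) → ℕ := fun l => if l = Fin.castSucc i ∨ l = Fin.last m then (1 : ℕ) else 0 with hWtdef
  set w' : Fin m → ℕ := fun l => if l = i then (1 : ℕ) else 0 with hw'def
  -- the move: identity coordinates, weights `Wt`
  have hmove : IsMove k (X : Fin (m + 1) → MvPowerSeries (Fin (m + 1)) k) Wt := by
    refine ⟨fun l => constantCoeff_X l, ?_, ⟨Fin.last m, by rw [hWtdef]; dsimp only; rw [if_pos (Or.inr rfl)]; exact one_pos⟩⟩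
    rw [← FormalCoordChange.linSubst_one, ConeDichotomy.linMat_linSubst, Matrix.det_one]
    exact isUnit_one
  refine Won.move X Wt hmove fun g hg => ?_
  obtain ⟨pt, a, ⟨l, hWl, hptl⟩, hfac, hndvd, hsing⟩ := hg
  have hself : subst (X : Fin (m + 1) → MvPowerSeries (Fin (m + 1)) k) P = P := by
    rw [subst_self]; rfl
  rw [hself] at hfac
  -- the saturated transform `g₀`
  set ci : k := pt (Fin.castSucc i) with hci
  set γ : k := pt (Fin.last m) with hγ
  set G : Fin d → MvPowerSeries (Fin (m + 1)) k := fun j =>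
    subst (cruxChart k w' (fun l => pt (Fin.castSucc l))) (A' j) with hGdef
  have hG0 : ∀ j, constantCoeff (G j) = 0 := fun j => by
    rw [hGdef]
    dsimp only
    rw [constantCoeff_subst_of_constantCoeff_zero _ (constantCoeff_cruxChart w' _), hA' j]
  set g₀ : MvPowerSeries (Fin (m + 1 + 1)) k := (C γ + X (Fin.last (m + 1))) ^ d +
    ∑ j : Fin d, (C ci + X (Fin.castSucc i).succ) ^ (d - (j : ℕ)) *
      rename (Fin.succAboveEmb (Fin.last (m + 1))) (G j) * (C γ + X (Fin.last (m + 1))) ^ (j : ℕ) with hg₀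
  have hT : subst (cruxChart k Wt pt) P = X 0 ^ d * g₀ := by
    rw [hP, transform_curve i A A' hdiv pt]
  have hndvd₀ : ¬ X 0 ∣ g₀ := not_X_dvd_g₀ i γ ci G
  have hfac₀ := hfac
  rw [hT] at hfac
  obtain ⟨-, hgg⟩ := X_pow_mul_eq_X_pow_mul 0 hfac hndvd₀ hndvd
  subst hgg
  -- `γ = 0`: otherwise `g₀(0) = γ^d ≠ 0`
  have hγ0 : γ = 0 := by
    have h00 := hsing.1
    rw [hg₀, constantCoeff_g₀ i γ ci G hG0] at h00
    exact pow_eq_zero_iff (n := d) (by omega) |>.mp h00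
  -- the live slot is `x_i` (the exceptional point is off the vertex and `γ = 0`)
  have hl : l = Fin.castSucc i := by
    have hpos : 0 < Wt l := hWl
    rw [hWtdef] at hpos
    dsimp only at hpos
    by_contra hne
    rcases Fin.eq_castSucc_or_eq_last l with ⟨i', rfl⟩ | rfl
    · rw [if_neg (fun h => h.elim (fun h1 => hne h1) (fun h2 => (Fin.castSucc_lt_last i').ne h2))] at hpos
      exact lt_irrefl 0 hpos
    · exact hptl hγ0
  subst hl
  have hci0 : ci ≠ 0 := hptl
  -- the tame slice at `x_i` (weight `1`)
  obtain ⟨Cb, hCb⟩ : ∃ Cb : Fin (m + 1) → k, ∀ l, Cb l = if 0 < Wt l then pt l else 0 := ⟨_, fun _ => rfl⟩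
  have hconvb : ∀ l, Wt l = 0 → Cb l = 0 := fun l hl => by rw [hCb, hl, if_neg (lt_irrefl 0)]
  have hccb : cruxChart k Wt pt = CobordantChart.chart Wt Cb := by
    rw [show Cb = fun l => if 0 < Wt l then pt l else 0 from funext hCb]
    exact CobordantChart.cruxChart_eq_chart Wt pt
  have hWti : Wt (Fin.castSucc i) = 1 := by rw [hWtdef]; dsimp only; rw [if_pos (Or.inl rfl)]
  have hCbi : Cb (Fin.castSucc i) ≠ 0 := by rw [hCb, hWti, if_pos one_pos]; exact hci0
  rw [hccb] at hfac₀
  obtain ⟨Φ₂, u, hΦ₂0, hΦ₂det, hu, hgeq⟩ := tameSlice p hp k (m + 1) P Wt Cb hconvb a g₀ hfac₀ (Fin.castSucc i) hCbi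
    (by rw [hWti]; exact hp.not_dvd_one)
  set S : MvPowerSeries (Fin (m + 1)) k := subst (fun j : Fin (m + 1 + 1) => if j = (Fin.castSucc i).succ
    then (0 : MvPowerSeries (Fin (m + 1)) k) else X (Fin.predAbove (Fin.castSucc i) j)) g₀ with hS
  suffices hWS : Won k (m + 1) S by
    rw [hgeq]
    exact (won_unit_mul_iff hu _).mpr ((won_subst_iff hΦ₂0 hΦ₂det _).mpr (won_cyl (Fin.castSucc i).succ hWS))
  -- the slice is the monic form of the statement
  have hchart' : cruxChart k w' (fun l => pt (Fin.castSucc l)) =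
      CobordantChart.chart w' (fun l : Fin m => if l = i then ci else 0) := by
    have hc : (fun l : Fin m => if l = i then ci else 0) = fun l => if 0 < w' l then pt (Fin.castSucc l) else 0 := by
      funext l
      rw [hw'def]
      dsimp only
      by_cases hli : l = i
      · rw [if_pos hli, if_pos (by rw [if_pos hli]; exact one_pos), hli]
      · rw [if_neg hli, if_neg (by rw [if_neg hli]; exact lt_irrefl 0)]
    rw [hc]
    exact CobordantChart.cruxChart_eq_chart w' _
  have hSeq : S = X (Fin.last m) ^ d +
      ∑ j : Fin d, rename (Fin.succAboveEmb (Fin.last m)) (C (ci ^ (d - (j : ℕ))) * TupleGame.slice i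
        (subst (CobordantChart.chart w' (fun l : Fin m => if l = i then ci else 0)) (A' j))) * X (Fin.last m) ^ (j : ℕ) := by
    rw [hS, hg₀, hγ0, slice_g₀ i ci G]
    simp only [hGdef, hchart']
  by_cases hSs : IsSingular k S
  · rw [hSeq] at hSs ⊢
    exact hsucc ci hci0 hSs
  · exact (wonBy_zero_of_not_isSingular m.succ_pos hSs).won


end Summit.ResolutionOfSingularities.ResolutionOfSingularities.Theorems
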